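import Summits.HubbardSuperconductivity.HubbardSuperconductivity.Theorems.WeakCouplingBCSKlLindhardEnclosureCeilStructuralOrd
import Summits.HubbardSuperconductivity.HubbardSuperconductivity.Theorems.WeakCouplingBCSKlLindhardEnclosureFloorRules

/-!
# KL-MARGIN-SCAN reader (22) «kernel-lindhard-enclosure» — the FLOOR side RE-KEYED TO ORIENTED CELLS INSIDE THE ROOT SQUARE

Located item «FLOOR-BDRY-ORIENTATION» (tribunal T2-2 g22, ✓ p731099
`Theorems/WcbcsKohnLuttingerB1g/Negative/LindhardEnclosureFloorBdryW20Unoriented.lean`): the floor rule predicates of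
`…FloorRules` (`FloorInsideSoundAt`, `FloorBdrySoundAt`) quantify over ALL integer cells, and the boundary one is FALSE as typed
at `P_W20` — on a REVERSED cell (`b < a`) the half-open box is empty while `floorBdry` can be positive (the direction test
`cosDirZ` does not check `u0 ≤ u1`).  The fused evaluation `QB.eval` never visits such a cell: from the root every visited cell is
inside the root square AND oriented (`Params.InRootOrd`, ✓ `…CeilStructuralOrd`).  This file is the floor twin of
`…CeilStructuralOrd` / `…CeilRulesOrd`: the per-leaf predicate `LeafFloorSoundOrd P` (admissible `P`, leaf cell in the root square,
`a ≤ b`, `c ≤ d`), the tree induction `eval_fst_le_cellIntBZ_ord` carrying the invariant, `floorSoundAt_of_leafFloorSoundOrd`, the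
two ORIENTED rule predicates of record `FloorInsideSoundOrd P` (Jensen floor) / `FloorBdrySoundOrd P` (boundary floor), the case
analysis `leafFloorSoundOrd_of_rules`, and `floorSoundAt_of_rulesOrd : FloorInsideSoundOrd P → FloorBdrySoundOrd P → ∀ t,
FloorSoundAt P t`.  The T2-2 witness (`b < a`) misses both oriented predicates.  Honest framing: reductions only — the two oriented
rules are NOT proved here; floats are floats; nothing in this file asserts a KL margin at any `t′ ≠ 0`, `K₃`, `U₀`, the window or
B1g dominance; a Kohn–Luttinger instability statement is not ODLRO and nothing here proves superconductivity in the Hubbard model.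
(p1 g26, 2026-08-29.)
-/

noncomputable section

set_option linter.dupNamespace false

namespace Summit.HubbardSuperconductivity.HubbardSuperconductivity.Theorems.KlLindhardEnclosure

open Real Set MeasureTheory Literature.MathematicalPhysics.QuantumLattice
open Summit.HubbardSuperconductivity.HubbardSuperconductivity.Theorems

/-! ## §1 The oriented per-leaf floor predicate and the tree induction -/

/-- **ORIENTED PER-LEAF FLOOR SOUNDNESS at `P`** (the floor discharge target of record): for admissible `P`, every leaf cell
INSIDE THE ROOT SQUARE and ORIENTED (`a ≤ b`, `c ≤ d`) with `mkX/mkY` corner records and every hint payload, if the two-shell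
integrand is integrable on the zone then the leaf's floor term (units `2^-30`) is at most `2^30 ·` the BZ-part of the cell
integral. [folklore] -/
def LeafFloorSoundOrd (P : Params) : Prop :=
  ∀ (bd : Option (ℕ × ℕ × ℕ × ℕ)) (tp : Option (ℕ × ℕ × ℕ × ℕ × ℕ × ℕ × ℕ × ℕ)) (a b c d : ℤ),
    P.admissible = true → P.InRoot a b c d → a ≤ b → c ≤ d →
    IntegrableOn P.integrand brillouinZone volume →
      (((P.leaf bd tp (P.mkX a) (P.mkX b) (P.mkY c) (P.mkY d)).1 : ℤ) : ℝ) ≤ 2 ^ 30 * P.cellIntBZ a b c d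

/-- **TREE INDUCTION OVER ORIENTED IN-ROOT CELLS (floor side)**: under the oriented per-leaf predicate, the fused floor sum of
ANY certificate tree on ANY oriented cell inside the root square is at most `2^30 ·` the BZ-part of that cell's integral. -/
theorem eval_fst_le_cellIntBZ_ord (P : Params) (hP : P.admissible = true) (hleaf : LeafFloorSoundOrd P)
    (hint : IntegrableOn P.integrand brillouinZone volume) (t : QB) :
    ∀ a b c d : ℤ, P.InRootOrd a b c d →
      (((t.eval P (P.mkX a) (P.mkX b) (P.mkY c) (P.mkY d)).1 : ℤ) : ℝ) ≤ 2 ^ 30 * P.cellIntBZ a b c d := by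
  have hU : 0 < P.U := P.U_pos_of_admissible hP
  induction t with
  | o => intro a b c d hin; simpa [QB.eval] using hleaf none none a b c d hP hin.1 hin.2.1 hin.2.2 hint
  | d σx σy τx τy =>
      intro a b c d hin
      simpa [QB.eval] using hleaf (some (σx, σy, τx, τy)) none a b c d hP hin.1 hin.2.1 hin.2.2 hint
  | w a1 a2 a3 a4 a5 a6 a7 a8 =>
      intro a b c d hin
      simpa [QB.eval] using hleaf none (some (a1, a2, a3, a4, a5, a6, a7, a8)) a b c d hP hin.1 hin.2.1 hin.2.2 hint
  | n c00 c10 c01 c11 ih00 ih10 ih01 ih11 =>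
      intro a b c d hin
      obtain ⟨k00, k10, k01, k11, -, -, -, -⟩ := Params.InRootOrd.mid P hin
      have h00 := ih00 a ((a + b) / 2) c ((c + d) / 2) k00
      have h10 := ih10 ((a + b) / 2) b c ((c + d) / 2) k10
      have h01 := ih01 a ((a + b) / 2) ((c + d) / 2) d k01
      have h11 := ih11 ((a + b) / 2) b ((c + d) / 2) d k11
      have hx1 := P.cellIntBZ_split_x hU hint (midpoint_between a b) c ((c + d) / 2)
      have hx2 := P.cellIntBZ_split_x hU hint (midpoint_between a b) ((c + d) / 2) d
      have hy := P.cellIntBZ_split_y hU hint a b (midpoint_between c d)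
      simp only [QB.eval, Params.mkX_z, Params.mkY_z, Int.cast_add]
      linarith
  | cx z l r ihl ihr =>
      intro a b c d hin
      simp only [QB.eval, Params.mkX_z]
      split_ifs with h
      · obtain ⟨kl, kr⟩ := Params.InRootOrd.cutx P hin h
        have hl := ihl a z c d kl
        have hr := ihr z b c d kr
        have hx := P.cellIntBZ_split_x hU hint (Or.inl ⟨h.1.le, h.2.le⟩) c d
        simp only [Int.cast_add]
        linarith
      · simp only [Int.cast_zero]
        have := P.cellIntBZ_nonneg a b c d
        positivity
  | cy z l r ihl ihr =>
      intro a b c d hin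
      simp only [QB.eval, Params.mkY_z]
      split_ifs with h
      · obtain ⟨kl, kr⟩ := Params.InRootOrd.cuty P hin h
        have hl := ihl a b c z kl
        have hr := ihr a b z d kr
        have hy := P.cellIntBZ_split_y hU hint a b (Or.inl ⟨h.1.le, h.2.le⟩)
        simp only [Int.cast_add]
        linarith
      · simp only [Int.cast_zero]
        have := P.cellIntBZ_nonneg a b c d
        positivity
  | bx l r ihl ihr =>
      intro a b c d hin
      obtain ⟨-, -, -, -, kl, kr, -, -⟩ := Params.InRootOrd.mid P hin
      have hl := ihl a ((a + b) / 2) c d kl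
      have hr := ihr ((a + b) / 2) b c d kr
      have hx := P.cellIntBZ_split_x hU hint (midpoint_between a b) c d
      simp only [QB.eval, Params.mkX_z, Int.cast_add]
      linarith
  | bY l r ihl ihr =>
      intro a b c d hin
      obtain ⟨-, -, -, -, -, -, kl, kr⟩ := Params.InRootOrd.mid P hin
      have hl := ihl a b c ((c + d) / 2) kl
      have hr := ihr a b ((c + d) / 2) d kr
      have hy := P.cellIntBZ_split_y hU hint a b (midpoint_between c d)
      simp only [QB.eval, Params.mkY_z, Int.cast_add]
      linarith

/-- **STRUCTURAL FLOOR SOUNDNESS (oriented form)**: `LeafFloorSoundOrd P → ∀ t, FloorSoundAt P t`. -/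
theorem floorSoundAt_of_leafFloorSoundOrd (P : Params) (hleaf : LeafFloorSoundOrd P) (t : QB) : FloorSoundAt P t := by
  intro hP hint
  have key := eval_fst_le_cellIntBZ_ord P hP hleaf hint t (-P.Xz) P.Xz (-P.Xz) P.Xz (P.inRootOrd_root hP)
  rw [P.cellIntBZ_root hP] at key
  exact key

/-! ## §2 The two ORIENTED floor rule predicates of record and the case analysis -/

/-- **JENSEN-FLOOR RULE (oriented, of record)**: admissible `P`; a GUARDED grid cell INSIDE THE ROOT SQUARE and ORIENTED
(`a ≤ b`, `c ≤ d`) whose two shell statuses are certified OPPOSITE (kind `k`) and which lies inside `[−piLoZ, piLoZ)²`;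
then the floor term `floorInside k` (units `2^-30`) is at most `2^30 ·` the BZ-part of the cell integral of the two-shell
integrand. [folklore] -/
def FloorInsideSoundOrd (P : Params) : Prop :=
  ∀ (a b c d : ℤ) (k : Bool), P.admissible = true → P.InRoot a b c d → a ≤ b → c ≤ d →
    (P.cell (P.mkX a) (P.mkX b) (P.mkY c) (P.mkY d)).guards = true →
    P.status (P.cell (P.mkX a) (P.mkX b) (P.mkY c) (P.mkY d)).e1Lo (P.cell (P.mkX a) (P.mkX b) (P.mkY c) (P.mkY d)).e1Hi = some k →
    P.status (P.cell (P.mkX a) (P.mkX b) (P.mkY c) (P.mkY d)).e2Lo (P.cell (P.mkX a) (P.mkX b) (P.mkY c) (P.mkY d)).e2Hi = some (!k) →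
    P.inBZ (P.mkX a) (P.mkX b) (P.mkY c) (P.mkY d) = true →
    IntegrableOn P.integrand brillouinZone volume →
      ((P.floorInside k (P.mkX a) (P.mkX b) (P.mkY c) (P.mkY d) : ℤ) : ℝ) ≤ 2 ^ 30 * P.cellIntBZ a b c d

/-- **BOUNDARY-FLOOR RULE (oriented, of record)**: admissible `P`; a GUARDED grid cell INSIDE THE ROOT SQUARE and ORIENTED
(`a ≤ b`, `c ≤ d`), inside `[−piLoZ, piLoZ)²`, where exactly one of the two points may straddle (`sh = true`: `p + q` straddles
and `p` has certified status `far`; `sh = false`: `p` straddles and `p + q` has status `far`); then the boundary floor term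
`floorBdry … sh (!far) σx σy` is at most `2^30 ·` the BZ-part of the cell integral, for EVERY hint payload `σx σy` (hints are
checked inside the rule, never trusted).  The T2-2 witness of ✓ p731099 (`b < a`) misses this statement. [folklore] -/
def FloorBdrySoundOrd (P : Params) : Prop :=
  ∀ (a b c d : ℤ) (sh far : Bool) (σx σy : ℕ), P.admissible = true → P.InRoot a b c d → a ≤ b → c ≤ d →
    (P.cell (P.mkX a) (P.mkX b) (P.mkY c) (P.mkY d)).guards = true →
    P.status (P.cell (P.mkX a) (P.mkX b) (P.mkY c) (P.mkY d)).e1Lo (P.cell (P.mkX a) (P.mkX b) (P.mkY c) (P.mkY d)).e1Hi =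
      (if sh then some far else none) →
    P.status (P.cell (P.mkX a) (P.mkX b) (P.mkY c) (P.mkY d)).e2Lo (P.cell (P.mkX a) (P.mkX b) (P.mkY c) (P.mkY d)).e2Hi =
      (if sh then none else some far) →
    P.inBZ (P.mkX a) (P.mkX b) (P.mkY c) (P.mkY d) = true →
    IntegrableOn P.integrand brillouinZone volume →
      ((P.floorBdry (P.cell (P.mkX a) (P.mkX b) (P.mkY c) (P.mkY d)) sh (!far) σx σy (P.mkX a) (P.mkX b) (P.mkY c) (P.mkY d) : ℤ) : ℝ)
        ≤ 2 ^ 30 * P.cellIntBZ a b c d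

/-- **THE ORIENTED PER-LEAF FLOOR DEBT IS THE TWO ORIENTED RULES**: `FloorInsideSoundOrd P ∧ FloorBdrySoundOrd P → LeafFloorSoundOrd P`.
Every other leaf (failed guards, same-side cells, tip cells, cells not inside the floor zone) carries floor term `0`, sound by
non-negativity of the integrand. -/
theorem leafFloorSoundOrd_of_rules (P : Params) (hI : FloorInsideSoundOrd P) (hB : FloorBdrySoundOrd P) : LeafFloorSoundOrd P := by
  intro bd tp a b c d hP hin hab hcd hint
  have h0 : (0 : ℝ) ≤ 2 ^ 30 * P.cellIntBZ a b c d := by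
    have := P.cellIntBZ_nonneg a b c d; positivity
  set x0 := P.mkX a with hx0
  set x1 := P.mkX b with hx1
  set y0 := P.mkY c with hy0
  set y1 := P.mkY d with hy1
  by_cases hg : (P.cell x0 x1 y0 y1).guards = true
  · rcases hs1 : P.status (P.cell x0 x1 y0 y1).e1Lo (P.cell x0 x1 y0 y1).e1Hi with _ | ⟨_ | _⟩ <;>
      rcases hs2 : P.status (P.cell x0 x1 y0 y1).e2Lo (P.cell x0 x1 y0 y1).e2Hi with _ | ⟨_ | _⟩
    · -- none, none : tip cell, floor 0
      simp only [Params.leaf, hg, hs1, hs2, Bool.not_true, Bool.false_eq_true, ↓reduceIte, Int.cast_zero]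
      exact h0
    · -- none, some false : p straddles, far = false
      by_cases hbz : P.inBZ x0 x1 y0 y1 = true
      · have := hB a b c d false false
        rcases bd with _ | ⟨σx, σy, τx, τy⟩
        · simp only [Params.leaf, hg, hs1, hs2, hbz, Bool.not_true, Bool.false_eq_true, ↓reduceIte]
          exact this _ _ hP hin hab hcd hg (by simpa using hs1) (by simpa using hs2) hbz hint
        · simp only [Params.leaf, hg, hs1, hs2, hbz, Bool.not_true, Bool.false_eq_true, ↓reduceIte]
          exact this σx σy hP hin hab hcd hg (by simpa using hs1) (by simpa using hs2) hbz hint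
      · rcases bd with _ | ⟨σx, σy, τx, τy⟩ <;>
          simp only [Params.leaf, hg, hs1, hs2, hbz, Bool.not_true, Bool.false_eq_true, ↓reduceIte, Int.cast_zero] <;> exact h0
    · -- none, some true
      by_cases hbz : P.inBZ x0 x1 y0 y1 = true
      · have := hB a b c d false true
        rcases bd with _ | ⟨σx, σy, τx, τy⟩
        · simp only [Params.leaf, hg, hs1, hs2, hbz, Bool.not_true, Bool.false_eq_true, ↓reduceIte]
          exact this _ _ hP hin hab hcd hg (by simpa using hs1) (by simpa using hs2) hbz hint
        · simp only [Params.leaf, hg, hs1, hs2, hbz, Bool.not_true, Bool.false_eq_true, ↓reduceIte]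
          exact this σx σy hP hin hab hcd hg (by simpa using hs1) (by simpa using hs2) hbz hint
      · rcases bd with _ | ⟨σx, σy, τx, τy⟩ <;>
          simp only [Params.leaf, hg, hs1, hs2, hbz, Bool.not_true, Bool.false_eq_true, ↓reduceIte, Int.cast_zero] <;>
          exact h0
    · -- some false, none : p + q straddles, far = false
      by_cases hbz : P.inBZ x0 x1 y0 y1 = true
      · have := hB a b c d true false
        rcases bd with _ | ⟨σx, σy, τx, τy⟩
        · simp only [Params.leaf, hg, hs1, hs2, hbz, Bool.not_true, Bool.not_false, Bool.false_eq_true, ↓reduceIte]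
          exact this _ _ hP hin hab hcd hg (by simpa using hs1) (by simpa using hs2) hbz hint
        · simp only [Params.leaf, hg, hs1, hs2, hbz, Bool.not_true, Bool.not_false, Bool.false_eq_true, ↓reduceIte]
          exact this σx σy hP hin hab hcd hg (by simpa using hs1) (by simpa using hs2) hbz hint
      · rcases bd with _ | ⟨σx, σy, τx, τy⟩ <;>
          simp only [Params.leaf, hg, hs1, hs2, hbz, Bool.not_true, Bool.not_false, Bool.false_eq_true, ↓reduceIte, Int.cast_zero] <;>
          exact h0
    · -- some false, some false : same side, floor 0
      simp only [Params.leaf, hg, hs1, hs2, Bool.not_true, Bool.false_eq_true, ↓reduceIte, Int.cast_zero]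
      exact h0
    · -- some false, some true : two-shell kind II (k = false)
      by_cases hbz : P.inBZ x0 x1 y0 y1 = true
      · simp only [Params.leaf, hg, hs1, hs2, hbz, Bool.not_true, Bool.false_eq_true, ↓reduceIte]
        exact hI a b c d false hP hin hab hcd hg hs1 hs2 hbz hint
      · simp only [Params.leaf, hg, hs1, hs2, hbz, Bool.not_true, Bool.false_eq_true, ↓reduceIte, Int.cast_zero]
        exact h0
    · -- some true, none : p + q straddles, far = true
      by_cases hbz : P.inBZ x0 x1 y0 y1 = true
      · have := hB a b c d true true
        rcases bd with _ | ⟨σx, σy, τx, τy⟩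
        · simp only [Params.leaf, hg, hs1, hs2, hbz, Bool.not_true, Bool.false_eq_true, ↓reduceIte]
          exact this _ _ hP hin hab hcd hg (by simpa using hs1) (by simpa using hs2) hbz hint
        · simp only [Params.leaf, hg, hs1, hs2, hbz, Bool.not_true, Bool.false_eq_true, ↓reduceIte]
          exact this σx σy hP hin hab hcd hg (by simpa using hs1) (by simpa using hs2) hbz hint
      · rcases bd with _ | ⟨σx, σy, τx, τy⟩ <;>
          simp only [Params.leaf, hg, hs1, hs2, hbz, Bool.not_true, Bool.false_eq_true, ↓reduceIte, Int.cast_zero] <;>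
          exact h0
    · -- some true, some false : two-shell kind I (k = true)
      by_cases hbz : P.inBZ x0 x1 y0 y1 = true
      · simp only [Params.leaf, hg, hs1, hs2, hbz, Bool.not_true, Bool.false_eq_true, ↓reduceIte]
        exact hI a b c d true hP hin hab hcd hg hs1 hs2 hbz hint
      · simp only [Params.leaf, hg, hs1, hs2, hbz, Bool.not_true, Bool.false_eq_true, ↓reduceIte, Int.cast_zero]
        exact h0
    · -- some true, some true : same side, floor 0
      simp only [Params.leaf, hg, hs1, hs2, Bool.not_true, Bool.false_eq_true, ↓reduceIte, Int.cast_zero]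
      exact h0
  · -- failed guards: (0, none)
    have hg' : (P.cell x0 x1 y0 y1).guards = false := by simpa using hg
    simp only [Params.leaf, hg', Bool.not_false, ↓reduceIte, Int.cast_zero]
    exact h0

/-- **FLOOR SOUNDNESS FROM THE TWO ORIENTED RULES, for every certificate tree** — the floor discharge route of record. -/
theorem floorSoundAt_of_rulesOrd (P : Params) (hI : FloorInsideSoundOrd P) (hB : FloorBdrySoundOrd P) (t : QB) :
    FloorSoundAt P t :=
  floorSoundAt_of_leafFloorSoundOrd P (leafFloorSoundOrd_of_rules P hI hB) t

/-- The unoriented Jensen-floor predicate of `…FloorRules` implies the oriented one (it over-quantifies); recorded so that a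
discharge of the old form, if anyone lands one, still feeds the route of record. -/
theorem floorInsideSoundOrd_of_at (P : Params) (h : FloorInsideSoundAt P) : FloorInsideSoundOrd P :=
  fun a b c d k _ _ _ _ hg hs1 hs2 hbz hint => h a b c d k hg hs1 hs2 hbz hint

end Summit.HubbardSuperconductivity.HubbardSuperconductivity.Theorems.KlLindhardEnclosure

end
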